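import Summits.BirchSwinnertonDyer.BirchSwinnertonDyer.Theorems.SylvesterTwoHeegnerIndexLowerHalfFourTorsionMembers
import Summits.BirchSwinnertonDyer.BirchSwinnertonDyer.Theorems.SylvesterTwoHeegnerIndexUpperOnV0
import HarnessLib

/-!
# Route `SylvesterTwoHeegnerIndex` (rung K7t), crux `HeegnerIndexLowerAtTwoHSYOfFacts` (item 19477,
# the facts-conditional twin of 19230): the LOWER half BY 2-DESCENT STRATUM — what each stratum of
# the census decides, the would-be 𝒱₀ / off-𝒱₀ glue, and the last `(ℤ/4)²`-row `p = 252283`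
# (helper toward stmt-BirchSwinnertonDyer-19477; cell «bsd-cm», seat `bsd-cm-k7t-c3` g4; theorems only)

HONEST FRAMING (cell «bsd-cm», `run/shared/lean/pub/bsd-cm/`; FULL-BSD RANK ≤ 1 programme, tranche
1a): the class 𝒞_HSY at `p = 2` (B14 / O12: `BSD(E_p, 2)` for `E_p : x³ + y³ = p`, `p ≡ 4, 7 (mod 9)`
prime, `3 ∉ 𝔽_p^{×3}`) is OPEN in print and stays open here. The crux 19477 quantifies over ALL `p`;
modulo the route's support item it is the main-conjecture half `ord₂ #Ш_an(E_p) ≤ ord₂ #Ш(E_p)`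
(`MissingLowerBoundAt W 2`) on the whole family (p417655), for which no tool exists at the inert
prime `2` of `ℤ[ω]` (Kolyvagin-conjecture direction; cell memo two §22.3). THEOREMS ONLY
(0 definitions, 0 named facts, 0 `sorry`); nothing here is a proof of the crux.

WHAT THIS FILE ADDS (all member-generic unless a numeral appears).
§1 Finite abelian groups: `Ш[2] = 0 ⇒ ord₂ #Ш = 0`; `Ш[2] = {0, x, y, x + y}` with `Ш[4] = Ш[2]`
   ⇒ `ord₂ #Ш = 2` (the strata PARI's `ellrank` types `[1,1,0]` / `[1,1,2]` certify, given rank `1`).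
§2 THE STRATA in Miller's currency, for globally minimal `W ≅ E_p` with displayed `#Ш_an(W) = q`,
   granted Hu–Shu–Yin 1.3/1.4 + Burungale–Flach + modularity: `MissingLowerBoundAt W 2 ⟺ 2^{ord₂ q} ∣
   #Ш(W)`; on the stratum `Ш(W)[2] = 0` it is `⟺ ord₂ q ≤ 0`; on `Ш(W)[2^∞] ≅ (ℤ/2)²` EXACTLY it is
   `⟺ ord₂ q ≤ 2`; on `(ℤ/4)² ↪ Ш(W)` it HOLDS whenever `ord₂ q ≤ 4`. So the route's KILL CRITERION
   is kernel-precise per stratum: LOWER FAILS at a member iff `#Ш_an` is even on a `[1,1,0]`-row, iff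
   `8 ∣ #Ш_an` on a `[1,1,2]`-row — never observed (7493 members `p ≤ 4·10⁵` typed; `#Ш_an` certified
   on all 507 members `p ≤ 2·10⁴` and all 79 `(ℤ/4)²`-rows).
§3 THE TWIN BY NAME `⟺ (PublishedFactsTwo → ∀ members, MissingLowerBoundAt W 2)`; and the PROVED glue
   a 𝒱₀ / off-𝒱₀ split of 19477 would use (mirror of the landed split 19476 → 19580/19581/19582):
   «pair product a `2`-adic UNIT on 𝒱₀» ∧ «lower pair bound off 𝒱₀» ⟹ 19477; antecedents OPEN.
§4 Row `p = 252283` (kit j254639: `#Ш_an = 16` EXACTLY, generator at `ellrank` effort 4, saturation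
   bound 8; `#Ш(E′) = 961`, `k′ = 0`): the 79-row table of `(ℤ/4)²`-members `p ≤ 4·10⁵` is COMPLETE —
   77 × `#Ш_an = 16` (LOWER holds), 2 × `#Ш_an = 64` (LISTED: 140557, 381181).

PARTITION (D-0054): CornerF at `2` / O12 × 𝒞_HSY members by `2`-descent stratum (book230: 6
classes; census `p ≤ 4·10⁵`: 6617 + 797 + 79) × `p = 2` — types-the-object-of (per-stratum decision
theorems + certificate consumers + glue); closes no cell and no class; nothing booked; no label moves.
References (locators only): [HuShuYin2019] Thm. 1.3/1.4 (p. 3), Cor. 4.4, (bsd) p. 12;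
[BurungaleFlach2024] Thm. 1.1, Cor. 2; [Miller2011LMS] §1, Def. 1.1; [Cremona1997] §3.6; Cassels,
J. reine angew. Math. 494 (1998) §1 (pairing on `Sel₂`, kernel = image of `Sel₄`); [GrossZagier1986]
I.(6.5), V.§2; parents p417655, p422193, p431591, p431676, p431798.
-/

set_option autoImplicit false
-- the Theorems namespace `Summit.BirchSwinnertonDyer.BirchSwinnertonDyer.…` repeats a component by design (D-0017 layout)
set_option linter.dupNamespace false

noncomputable section

open scoped Classical

open WeierstrassCurve NumberField Literature.NumberTheory.EllipticCurves
  Literature.NumberTheory.EllipticCurves.ModularForms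
  Literature.NumberTheory.EllipticCurves.Rank1Residual
  Literature.NumberTheory.EllipticCurves.Rank1Residual.Typed
  Literature.NumberTheory.EllipticCurves.HuShuYin2019
  Summit.BirchSwinnertonDyer.Rank1Residual.P2
  Summit.BirchSwinnertonDyer.Rank1Residual.X12.Sylvester
  Summit.BirchSwinnertonDyer.BirchSwinnertonDyer.Theses.SylvesterTwoHeegnerIndex

namespace Summit.BirchSwinnertonDyer.BirchSwinnertonDyer.Theorems

namespace SylvesterTwoLowerCert

/-! ## §1 Finite abelian groups: the two strata a `2`-descent types exactly -/

section GroupTheory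

variable {G : Type*} [AddCommGroup G]

/-- **No element of order `2` ⟹ `2 ∤ #G`** (Cauchy), for a finite additive group. [folklore] -/
theorem not_two_dvd_card_of_twoTorsion_trivial [Finite G]
    (h0 : ∀ z : G, (2 : ℤ) • z = 0 → z = 0) : ¬ 2 ∣ Nat.card G := by
  intro hdvd
  haveI : Fact (Nat.Prime 2) := ⟨Nat.prime_two⟩
  obtain ⟨x, hx⟩ := exists_prime_addOrderOf_dvd_card' (G := G) 2 hdvd
  have h2x : (2 : ℤ) • x = 0 := by
    have h := addOrderOf_nsmul_eq_zero x
    rw [hx] at h; exact_mod_cast h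
  rw [h0 x h2x, addOrderOf_zero] at hx
  exact absurd hx (by norm_num)

/-- **`G[2] = 0 ⟹ ord₂ #G = 0`** for a finite additive group. [folklore] -/
theorem padicValNat_two_card_of_twoTorsion_trivial [Finite G]
    (h0 : ∀ z : G, (2 : ℤ) • z = 0 → z = 0) : padicValNat 2 (Nat.card G) = 0 :=
  padicValNat.eq_zero_of_not_dvd (not_two_dvd_card_of_twoTorsion_trivial h0)

/-- If `G[4] = G[2]` (every element killed by `4` is killed by `2`) then every element killed by a
power `2ⁿ⁺¹` is killed by `2`. [folklore] -/
theorem two_smul_eq_zero_of_pow_smul_eq_zero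
    (h4 : ∀ z : G, (4 : ℤ) • z = 0 → (2 : ℤ) • z = 0) :
    ∀ (n : ℕ) (z : G), ((2 : ℤ) ^ (n + 1)) • z = 0 → (2 : ℤ) • z = 0 := by
  intro n
  induction n with
  | zero => intro z hz; simpa using hz
  | succ n ih =>
    intro z hz
    have h' : (4 : ℤ) • (((2 : ℤ) ^ n) • z) = 0 := by
      rw [smul_smul, show (4 : ℤ) * 2 ^ n = 2 ^ (n + 1 + 1) by ring]; exact hz
    have h'' := h4 _ h'
    rw [smul_smul, show (2 : ℤ) * 2 ^ n = 2 ^ (n + 1) by ring] at h''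
    exact ih z h''

/-- **`G[2] = {0, x, y, x + y}` a Klein four-group and `G[4] = G[2]` ⟹ `ord₂ #G = 2`** for a finite
additive group: the `2`-primary component is exactly `G[2]`, of order `4`. This is what PARI's
`ellrank` type `[1, 1, 2]` certifies for `Ш(E_p)` given `rank E_p(ℚ) = 1` (`dim Sel₂ = 3`, the
Cassels–Tate pairing on `Ш[2]` non-degenerate). [folklore] -/
theorem padicValNat_two_card_of_kleinFour_exact [Finite G] {x y : G}
    (hx : (2 : ℤ) • x = 0) (hy : (2 : ℤ) • y = 0) (hx0 : x ≠ 0) (hy0 : y ≠ 0) (hxy : x ≠ y)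
    (hall : ∀ z : G, (2 : ℤ) • z = 0 → z = 0 ∨ z = x ∨ z = y ∨ z = x + y)
    (h4 : ∀ z : G, (4 : ℤ) • z = 0 → (2 : ℤ) • z = 0) :
    padicValNat 2 (Nat.card G) = 2 := by
  haveI : Fact (Nat.Prime 2) := ⟨Nat.prime_two⟩
  rw [← padicValNat_card_addPrimaryComponent 2]
  set P := AddCommGroup.primaryComponent G 2 with hP
  -- membership in the `2`-primary component is `2 • z = 0`
  have hmem : ∀ z : G, z ∈ P ↔ (2 : ℤ) • z = 0 := by
    intro z
    rw [hP, AddCommGroup.mem_primaryComponent]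
    constructor
    · rintro ⟨k, hk⟩
      cases k with
      | zero => simp only [pow_zero, one_smul] at hk; rw [hk, smul_zero]
      | succ k =>
        refine two_smul_eq_zero_of_pow_smul_eq_zero h4 k z ?_
        have : ((2 ^ (k + 1) : ℕ) : ℤ) • z = 0 := by rw [natCast_zsmul]; exact hk
        exact_mod_cast this
    · intro hz
      exact ⟨1, by rw [← natCast_zsmul]; exact_mod_cast hz⟩
  -- lower bound: the Klein four lies in `P`
  have hxP : x ∈ P := (hmem x).mpr hx
  have hyP : y ∈ P := (hmem y).mpr hy
  have h4dvd : 4 ∣ Nat.card P := by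
    refine four_dvd_card_of_kleinFour (G := P) (x := ⟨x, hxP⟩) (y := ⟨y, hyP⟩) ?_ ?_ ?_ ?_ ?_
    · exact Subtype.ext (by simpa using hx)
    · exact Subtype.ext (by simpa using hy)
    · exact fun h => hx0 (congrArg Subtype.val h)
    · exact fun h => hy0 (congrArg Subtype.val h)
    · exact fun h => hxy (congrArg Subtype.val h)
  -- upper bound: `P ⊆ {0, x, y, x + y}`
  have hle : Nat.card P ≤ 4 := by
    let S : Finset G := {0, x, y, x + y}
    have hsub : ∀ z : P, (z : G) ∈ S := fun z => by
      have hz := hall z ((hmem z).mp z.2)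
      simp only [S, Finset.mem_insert, Finset.mem_singleton]
      exact hz
    let f : P → S := fun z => ⟨z, hsub z⟩
    have hf : Function.Injective f := fun a b h => Subtype.ext (by simpa [f] using congrArg Subtype.val h)
    calc Nat.card P ≤ Nat.card S := Nat.card_le_card_of_injective f hf
      _ = S.card := by rw [Nat.card_eq_fintype_card, Fintype.card_coe]
      _ ≤ 4 := Finset.card_le_four
  have hcard : Nat.card P = 4 := by
    obtain ⟨c, hc⟩ := h4dvd
    have hpos : 0 < Nat.card P := Nat.card_pos
    have hc1 : c = 1 := by
      rcases Nat.lt_or_ge c 2 with h | h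
      · interval_cases c
        · rw [hc] at hpos; simp at hpos
        · rfl
      · rw [hc] at hle; omega
    rw [hc, hc1]
  rw [hcard, show (4 : ℕ) = 2 ^ 2 by norm_num, padicValNat.prime_pow]

end GroupTheory

/-! ## §2 The strata, in Miller's currency (`MissingLowerBoundAt W 2`), member-generic -/

section Strata

variable {p : ℕ} (W : WeierstrassCurve ℚ) [W.IsElliptic] [W.IsGloballyMinimal]

/-- **LOWER at a member ⟺ `2^{ord₂ #Ш_an} ∣ #Ш`.** For globally minimal `W ≅ E_p` (`p` in 𝒞_HSY)
with displayed `#Ш_an(W) = q`, `ord₂ q = n`, granted Hu–Shu–Yin (finiteness of `Ш(E_p)`),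
Burungale–Flach and modularity: `MissingLowerBoundAt W 2 ⟺ 2ⁿ ∣ #Ш(W)`. Frame-free companion of
part C's `lower_frame_iff_pow_dvd`. [cite: HuShuYin2019, Thm. 1.3 and Thm. 1.4 (p. 3)]
[cite: Miller2011LMS, §1 and Def. 1.1] -/
theorem missingLowerBoundAt_iff_pow_dvd
    (hHSY : thm14_threePart_product) (hBF : bsdTriple_of_hasCM_of_L_one_ne_zero)
    (hmod : hasEntireLFunction_rat)
    (hp : p.Prime) (h9 : p % 9 = 4 ∨ p % 9 = 7) (h3 : ¬ ∃ x : ZMod p, x ^ 3 = 3)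
    (hW : ∃ C : VariableChange ℚ, C • W = cubeSumCurve (p : ℚ))
    {q : ℚ} (hq : shaAn W = (q : ℂ)) {n : ℕ} (hv : padicValRat 2 q = n) :
    MissingLowerBoundAt W 2 ↔ 2 ^ n ∣ Nat.card W.sha := by
  haveI : Fact (Nat.Prime 2) := ⟨Nat.prime_two⟩
  obtain ⟨-, hfin, -⟩ :=
    Summit.BirchSwinnertonDyer.Rank1Residual.X12.CubeSumFamilies.bsdp_three_of_thm14' hHSY hBF hmod hp h9 h3 W hW
  haveI := hfin
  have hcard : Nat.card W.sha ≠ 0 := (Nat.card_pos (α := W.sha)).ne'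
  constructor
  · rintro ⟨q', hq', hle⟩
    have hqq : q' = q := by exact_mod_cast hq'.symm.trans hq
    rw [hqq, hv, WeierstrassCurve.shaOrder] at hle
    exact (padicValNat_dvd_iff_le hcard).mpr (by exact_mod_cast hle)
  · intro hdvd
    refine ⟨q, hq, ?_⟩
    rw [hv, WeierstrassCurve.shaOrder]
    exact_mod_cast (padicValNat_dvd_iff_le hcard).mp hdvd

/-- **Stratum `Ш(E_p)[2] = 0`** (PARI `ellrank` type `[1, 1, 0]`, `dim Sel₂(E_p) = 1`; 6617 of the
7493 members `p ≤ 4·10⁵`): LOWER at the member ⟺ `ord₂ #Ш_an ≤ 0`. So the LOWER half FAILS at such a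
member iff `#Ш_an(E_p)` is EVEN — the sharpest per-member falsification test of item 19477 on this
stratum (never observed: `#Ш_an` odd on all 465 such members `p ≤ 2·10⁴`, bsd-cm-two N5′/N5′-ext).
[cite: HuShuYin2019, Thm. 1.3 and Thm. 1.4 (p. 3)] [cite: Miller2011LMS, §1 and Def. 1.1]
[cite: Cremona1997, §3.6] -/
theorem missingLowerBoundAt_iff_of_shaTwo_trivial
    (hHSY : thm14_threePart_product) (hBF : bsdTriple_of_hasCM_of_L_one_ne_zero)
    (hmod : hasEntireLFunction_rat)
    (hp : p.Prime) (h9 : p % 9 = 4 ∨ p % 9 = 7) (h3 : ¬ ∃ x : ZMod p, x ^ 3 = 3)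
    (hW : ∃ C : VariableChange ℚ, C • W = cubeSumCurve (p : ℚ))
    {q : ℚ} (hq : shaAn W = (q : ℂ))
    (h0 : ∀ z : W.sha, (2 : ℤ) • z = 0 → z = 0) :
    MissingLowerBoundAt W 2 ↔ padicValRat 2 q ≤ 0 := by
  haveI : Fact (Nat.Prime 2) := ⟨Nat.prime_two⟩
  obtain ⟨-, hfin, -⟩ :=
    Summit.BirchSwinnertonDyer.Rank1Residual.X12.CubeSumFamilies.bsdp_three_of_thm14' hHSY hBF hmod hp h9 h3 W hW
  haveI := hfin
  have hv0 : padicValNat 2 (Nat.card W.sha) = 0 := padicValNat_two_card_of_twoTorsion_trivial h0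
  constructor
  · rintro ⟨q', hq', hle⟩
    have hqq : q' = q := by exact_mod_cast hq'.symm.trans hq
    rw [hqq, WeierstrassCurve.shaOrder, hv0] at hle
    exact_mod_cast hle
  · intro hle
    refine ⟨q, hq, ?_⟩
    rw [WeierstrassCurve.shaOrder, hv0]
    exact_mod_cast hle

/-- **Stratum `Ш(E_p)[2^∞] ≅ (ℤ/2)²` EXACTLY** (PARI `ellrank` type `[1, 1, 2]`: `dim Sel₂(E_p) = 3`
and the Cassels–Tate pairing on `Ш[2]` non-degenerate, i.e. `Ш[2] = {0, x, y, x + y}` and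
`Ш[4] = Ш[2]`; 797 of the 7493 members `p ≤ 4·10⁵`): LOWER at the member ⟺ `ord₂ #Ш_an ≤ 2`. So the
LOWER half FAILS there iff `8 ∣ #Ш_an(E_p)` (never observed: `#Ш_an = 4` on all 41 such members
`p ≤ 2·10⁴`). [cite: HuShuYin2019, Thm. 1.3 and Thm. 1.4 (p. 3)] [cite: Miller2011LMS, §1 and Def. 1.1]
[cite: Cremona1997, §3.6] -/
theorem missingLowerBoundAt_iff_of_kleinFour_exact
    (hHSY : thm14_threePart_product) (hBF : bsdTriple_of_hasCM_of_L_one_ne_zero)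
    (hmod : hasEntireLFunction_rat)
    (hp : p.Prime) (h9 : p % 9 = 4 ∨ p % 9 = 7) (h3 : ¬ ∃ x : ZMod p, x ^ 3 = 3)
    (hW : ∃ C : VariableChange ℚ, C • W = cubeSumCurve (p : ℚ))
    {q : ℚ} (hq : shaAn W = (q : ℂ))
    {x y : W.sha} (hx : (2 : ℤ) • x = 0) (hy : (2 : ℤ) • y = 0) (hx0 : x ≠ 0) (hy0 : y ≠ 0)
    (hxy : x ≠ y) (hall : ∀ z : W.sha, (2 : ℤ) • z = 0 → z = 0 ∨ z = x ∨ z = y ∨ z = x + y)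
    (h4 : ∀ z : W.sha, (4 : ℤ) • z = 0 → (2 : ℤ) • z = 0) :
    MissingLowerBoundAt W 2 ↔ padicValRat 2 q ≤ 2 := by
  haveI : Fact (Nat.Prime 2) := ⟨Nat.prime_two⟩
  obtain ⟨-, hfin, -⟩ :=
    Summit.BirchSwinnertonDyer.Rank1Residual.X12.CubeSumFamilies.bsdp_three_of_thm14' hHSY hBF hmod hp h9 h3 W hW
  haveI := hfin
  have hv2 : padicValNat 2 (Nat.card W.sha) = 2 :=
    padicValNat_two_card_of_kleinFour_exact hx hy hx0 hy0 hxy hall h4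
  constructor
  · rintro ⟨q', hq', hle⟩
    have hqq : q' = q := by exact_mod_cast hq'.symm.trans hq
    rw [hqq, WeierstrassCurve.shaOrder, hv2] at hle
    exact_mod_cast hle
  · intro hle
    refine ⟨q, hq, ?_⟩
    rw [WeierstrassCurve.shaOrder, hv2]
    exact_mod_cast hle

/-- **Stratum `(ℤ/4)² ↪ Ш(E_p)`** (PARI `ellrank` type `[1, 3, 0]`: a Klein four in `Ш[2]` and
`Ш[2] ⊆ 2·Ш`; 79 members `p ≤ 4·10⁵`): LOWER at the member HOLDS whenever `ord₂ #Ш_an ≤ 4` — the 77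
certified rows `#Ш_an = 16`; Miller-currency form of `lower_member_of_cert`.
[cite: HuShuYin2019, Thm. 1.3 and Thm. 1.4 (p. 3)] [cite: Miller2011LMS, §1 and Def. 1.1]
[cite: Cremona1997, §3.6] -/
theorem missingLowerBoundAt_of_kleinFour_twoDivisible
    (hHSY : thm14_threePart_product) (hBF : bsdTriple_of_hasCM_of_L_one_ne_zero)
    (hmod : hasEntireLFunction_rat)
    (hp : p.Prime) (h9 : p % 9 = 4 ∨ p % 9 = 7) (h3 : ¬ ∃ x : ZMod p, x ^ 3 = 3)
    (hW : ∃ C : VariableChange ℚ, C • W = cubeSumCurve (p : ℚ))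
    {q : ℚ} (hq : shaAn W = (q : ℂ)) (hv : padicValRat 2 q ≤ 4)
    (hK4 : ∃ x y : W.sha, (2 : ℤ) • x = 0 ∧ (2 : ℤ) • y = 0 ∧ x ≠ 0 ∧ y ≠ 0 ∧ x ≠ y)
    (hdiv : ∀ z : W.sha, (2 : ℤ) • z = 0 → ∃ w : W.sha, (2 : ℤ) • w = z) :
    MissingLowerBoundAt W 2 := by
  haveI : Fact (Nat.Prime 2) := ⟨Nat.prime_two⟩
  obtain ⟨-, hfin, -⟩ :=
    Summit.BirchSwinnertonDyer.Rank1Residual.X12.CubeSumFamilies.bsdp_three_of_thm14' hHSY hBF hmod hp h9 h3 W hW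
  haveI := hfin
  obtain ⟨x, y, hx, hy, hx0, hy0, hxy⟩ := hK4
  have h16 : 2 ^ 4 ∣ Nat.card W.sha := by
    simpa using sixteen_dvd_card_of_kleinFour_of_twoDivisible hx hy hx0 hy0 hxy hdiv
  have hcard : Nat.card W.sha ≠ 0 := (Nat.card_pos (α := W.sha)).ne'
  refine ⟨q, hq, ?_⟩
  rw [WeierstrassCurve.shaOrder]
  have h4 : (4 : ℤ) ≤ padicValNat 2 (Nat.card W.sha) := by
    exact_mod_cast (padicValNat_dvd_iff_le hcard).mp h16
  exact hv.trans h4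

end Strata

/-! ## §3 The twin by name, and the glue of a would-be 𝒱₀ / off-𝒱₀ split of item 19477 -/

/-- **The twin in Miller's per-curve currency.** `HeegnerIndexLowerAtTwoHSYOfFacts` (item 19477)
holds iff, granted `PublishedFactsTwo`, every globally minimal model of every member of 𝒞_HSY
satisfies `MissingLowerBoundAt W 2` (p417655 under the antecedent; the twin is literally
`PublishedFactsTwo → HeegnerIndexLowerAtTwoHSY`). OPEN AS A CLASS; nothing asserted.
[cite: Miller2011LMS, §1 and Def. 1.1] [cite: HuShuYin2019, Thm. 1.3 and Thm. 1.4 (p. 3)] -/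
theorem lowerOfFacts_iff_forall_missingLowerBoundAt :
    HeegnerIndexLowerAtTwoHSYOfFacts ↔
      (PublishedFactsTwo → ∀ (p : ℕ), p.Prime → (p % 9 = 4 ∨ p % 9 = 7) → (¬ ∃ x : ZMod p, x ^ 3 = 3) →
        ∀ (W : WeierstrassCurve ℚ) [W.IsElliptic] [W.IsGloballyMinimal],
          (∃ C : VariableChange ℚ, C • W = cubeSumCurve (p : ℚ)) → MissingLowerBoundAt W 2) := by
  rw [SylvesterTwoUpper.lowerOfFacts_iff]
  exact ⟨fun h hF => (SylvesterTwoLower.heegnerIndexLowerAtTwoHSY_iff_missingLowerBoundAt_onFamily hF).mp (h hF),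
    fun h hF => (SylvesterTwoLower.heegnerIndexLowerAtTwoHSY_iff_missingLowerBoundAt_onFamily hF).mpr (h hF)⟩

/-- **GLUE for a 𝒱₀ / off-𝒱₀ split of the LOWER crux** (the mirror image of the route's landed split
of the UPPER twin 19476 into 19580 / 19581 with glue 19582; NOT filed as items — planner's call).
On 𝒱₀ = {`Ш(E_p)[2^∞] = 1 ∧ Ш(E_{3p²})[2^∞] = 1`} the LOWER half says that Hu–Shu–Yin's pair product
`#Ш_an(E_p)·#Ш_an(E_{3p²})` is a `2`-adic UNIT (the HSY Heegner point is `2`-primitive; cell memo two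
§22 N7 in pair currency — OPEN); off 𝒱₀ it is the pair bound `ord₂(#Ш_an(B)·#Ш_an(A)) ≤
ord₂ #Ш(B)[2^∞] + ord₂ #Ш(A)[2^∞]` (OPEN). Both granted ⟹ item 19477, by
`SylvesterTwoUpper.missingLowerBoundAt_of_pair_unit` on 𝒱₀ and `…missingLowerBoundAt_iff_pairBound`
off 𝒱₀. PROVED glue; antecedents displayed verbatim, nothing asserted about them.
[cite: HuShuYin2019, Cor. 4.4 and (bsd) p. 12] [cite: BurungaleFlach2024, Thm. 1.1 and Cor. 2]
[cite: Miller2011LMS, §1 and Def. 1.1] -/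
theorem lowerOfFacts_of_pairUnitOnV0_of_lowerOffV0
    (hon : PublishedFactsTwo → ∀ (p : ℕ), p.Prime → (p % 9 = 4 ∨ p % 9 = 7) →
      (¬ ∃ x : ZMod p, x ^ 3 = 3) →
      ∀ (A B : WeierstrassCurve ℚ) [A.IsElliptic] [A.IsGloballyMinimal] [B.IsElliptic]
        [B.IsGloballyMinimal], (∃ C : VariableChange ℚ, C • B = cubeSumCurve (p : ℚ)) →
        (∃ C : VariableChange ℚ, C • A = cubeSumCurve (3 * (p : ℚ) ^ 2)) →
        (Nat.card (AddCommGroup.primaryComponent B.sha 2) = 1 ∧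
          Nat.card (AddCommGroup.primaryComponent A.sha 2) = 1) →
        ∃ qB qA : ℚ, shaAn B = (qB : ℂ) ∧ shaAn A = (qA : ℂ) ∧ padicValRat 2 (qB * qA) = 0)
    (hoff : PublishedFactsTwo → ∀ (p : ℕ), p.Prime → (p % 9 = 4 ∨ p % 9 = 7) →
      (¬ ∃ x : ZMod p, x ^ 3 = 3) →
      ∀ (A B : WeierstrassCurve ℚ) [A.IsElliptic] [A.IsGloballyMinimal] [B.IsElliptic]
        [B.IsGloballyMinimal], (∃ C : VariableChange ℚ, C • B = cubeSumCurve (p : ℚ)) →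
        (∃ C : VariableChange ℚ, C • A = cubeSumCurve (3 * (p : ℚ) ^ 2)) →
        ¬ (Nat.card (AddCommGroup.primaryComponent B.sha 2) = 1 ∧
          Nat.card (AddCommGroup.primaryComponent A.sha 2) = 1) →
        ∃ qB qA : ℚ, shaAn B = (qB : ℂ) ∧ shaAn A = (qA : ℂ) ∧ qB * qA ≠ 0 ∧
          padicValRat 2 (qB * qA) ≤
            (padicValNat 2 (Nat.card (AddCommGroup.primaryComponent B.sha 2)) : ℤ) +
              (padicValNat 2 (Nat.card (AddCommGroup.primaryComponent A.sha 2)) : ℤ)) :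
    HeegnerIndexLowerAtTwoHSYOfFacts := by
  refine SylvesterTwoUpper.lowerOfFacts_iff_pairBound.mpr fun hF p hp h9 h3 A B _ _ _ _ hB hA => ?_
  by_cases hV : Nat.card (AddCommGroup.primaryComponent B.sha 2) = 1 ∧
      Nat.card (AddCommGroup.primaryComponent A.sha 2) = 1
  · obtain ⟨qB, qA, hqB, hqA, h0⟩ := hon hF p hp h9 h3 A B hB hA hV
    have hF' := hF
    obtain ⟨hHSY, hCM0, hmod, -⟩ := hF'
    exact (SylvesterTwoUpper.missingLowerBoundAt_iff_pairBound hHSY hCM0 hmod hp h9 h3 A B hB hA).mp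
      (SylvesterTwoUpper.missingLowerBoundAt_of_pair_unit hHSY hCM0 hmod hp h9 h3 A B hB hA hqB hqA h0)
  · exact hoff hF p hp h9 h3 A B hB hA hV

/-! ## §4 The last `(ℤ/4)²`-row: `E_{252283} : x³ + y³ = 252283` (`p ≡ 4 (mod 9)`; conductor
`27·252283²`; `#Ш_an = 16`; kit j254639) -/

/-- `252283` is an 𝒞_HSY parameter: prime, `252283 ≡ 4 (mod 9)`, and `3` is not a cube mod `252283`
(Euler: `3^((252283−1)/3) = 3^84094 ≢ 1 (mod 252283)`). [cite: HuShuYin2019, Thm. 1.4 (p. 3)] -/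
theorem hsy_252283 :
    Nat.Prime 252283 ∧ (252283 % 9 = 4 ∨ 252283 % 9 = 7) ∧ ¬ ∃ x : ZMod 252283, x ^ 3 = 3 :=
  hsy_of_pow_mod_ne_one (by norm_num) (Or.inl rfl) (by decide +kernel)

/-- **The LOWER crux at `p = 252283`** (body of `HeegnerIndexLowerAtTwoHSY` verbatim, `p := 252283`;
with `hF` curried this IS the twin 19477 at that member), from `PublishedFactsTwo` + two DISPLAYED
certificates NOT proved in the kernel (kit j254639, script sha16 d6292de9dc805934; reading key in part
A's header): `hq : #Ш_an(E_{252283}) = 16` — two engines `|L′_A − L′_B| = 1.3·10⁻²⁶`,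
`S ∈ [15.99986, 16.00003]` ∋ unique lattice point `4²·1`; generator
`P = (7900805241746619409/282109243947664, 21391935816836690446161943641/4738337329143310891712)` on
`y² + py = x³ − 7p²`-type model (`ellrank` effort 4; `ĥ = 35.38483`, inside the engine-B interval;
saturation index bound `8`, witnesses `{2: [5,6], 3: [5,6], 5: [59,60], 7: [31,21]}`; no cubic
solution `a³ + b³ = 252283·c³` with `c ≤ 6000`); `#Ш(E_{3·252283²}) = 961`, `m(252283) = 2`,
`Cl(ℚ(∛(4·252283))) ≅ [6, 6]` (`bnfcertify` = 1), `k′ = 0` — and `hS : Ш(E_{252283})[2] ≅ (ℤ/2)² ⊆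
2·Ш(E_{252283})` (`ellrank = [1, 3, 0]` at efforts `0–10`). Hence `ord₂ 𝔮 = 4 ≤ ord₂ #Ш(W)` in every
frame. CONDITIONAL; EVIDENCE consumer; says nothing about other `p`.
[cite: HuShuYin2019, Thm. 1.3 and Thm. 1.4 (p. 3)] [cite: BurungaleFlach2024, Thm. 1.1 and Cor. 2]
[cite: Miller2011LMS, §1 and Def. 1.1] [cite: Cremona1997, §3.6] -/
theorem sylvesterTwoHeegnerIndex_heegnerIndexLowerAtTwoHSY_252283 (hF : PublishedFactsTwo)
    (hq : ∀ (W : WeierstrassCurve ℚ) [W.IsElliptic] [W.IsGloballyMinimal],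
      (∃ C : VariableChange ℚ, C • W = cubeSumCurve ((252283 : ℕ) : ℚ)) → shaAn W = ((16 : ℚ) : ℂ))
    (hS : ∀ (W : WeierstrassCurve ℚ) [W.IsElliptic] [W.IsGloballyMinimal],
      (∃ C : VariableChange ℚ, C • W = cubeSumCurve ((252283 : ℕ) : ℚ)) →
        (∃ x y : W.sha, (2 : ℤ) • x = 0 ∧ (2 : ℤ) • y = 0 ∧ x ≠ 0 ∧ y ≠ 0 ∧ x ≠ y) ∧
        (∀ z : W.sha, (2 : ℤ) • z = 0 → ∃ w : W.sha, (2 : ℤ) • w = z)) :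
    ∀ (W : WeierstrassCurve ℚ) [W.IsElliptic] [W.IsGloballyMinimal],
      (∃ C : VariableChange ℚ, C • W = cubeSumCurve ((252283 : ℕ) : ℚ)) →
      ∀ (N : ℕ) [NeZero N] (K : Type) [Field K] [NumberField K]
        (Dt : ModularParametrizationData W N) (H : HeegnerDatum N (NumberField.discr K)) (ι : K →+* ℂ)
        (P : (W.baseChange K).toAffine.Point) (Wd : WeierstrassCurve ℚ) [Wd.IsElliptic]
        [Wd.IsGloballyMinimal] (Cd : VariableChange ℚ) (k : ℕ),
        W.HasCM → W.analyticRank = 1 → IsImaginaryQuadratic K → SatisfiesHeegnerHypothesis N K →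
        WeierstrassCurve.Affine.Point.map ι.toRatAlgHom P = heegnerPointComplex Dt H →
        (W.quadraticTwist (NumberField.discr K : ℚ)).entireLFunction 1 ≠ 0 →
        Cd • W.quadraticTwist (NumberField.discr K : ℚ) = Wd → (k = 1 ∨ k = 2) →
        (k = 2 ↔ ∀ y : W.toAffine.Point, ∃ Q : (W.baseChange K).toAffine.Point,
          QuadraticDescent.incl K W y - (2 : ℤ) • Q ∈ AddCommGroup.torsion (W.baseChange K).toAffine.Point) →
        padicValRat 2 (cmHeegnerIndexQuotient W K P Dt.c k Wd Cd.u) ≤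
          padicValNat 2 (Nat.card W.sha) :=
  lower_member_of_cert hsy_252283 hF (q := 16) padicValRat_two_16.le hq hS

end SylvesterTwoLowerCert

end Summit.BirchSwinnertonDyer.BirchSwinnertonDyer.Theorems

end
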